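import Literature.Probability.Distributions.GaussianWickTheorem
import Literature.MathematicalPhysics.QuantumFieldTheory.Balaban1983to89.B3WT226Traces
import Literature.MathematicalPhysics.QuantumFieldTheory.Balaban1983to89.B3GaussianContractions
import Literature.MathematicalPhysics.QuantumFieldTheory.Balaban1983to89.B3WTPeriodicMeasure

/-
Copyright: statement-level skeleton of a published paper (lit-balaban cell, Phase-2 proof seat p39 gen 13). No proof claims
beyond what the kernel checks below.
-/

/-!
# B3 — T. Bałaban, *(Higgs)₂,₃ quantum fields in a finite volume. III. Renormalization*, CMP **88** (1983) 411–445
[Balaban1983Higgs3], (2.26)–(2.28) p. 431 and p. 414: **WICK'S THEOREM OF EVERY ORDER FOR THE GAUSSIAN MEASURE `dμ_{C^η_{M²}}`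
ON THE CONCRETE LATTICE MODEL** — all the moments `∫dφ e^{−½⟨φ,(−Δ^η+M²)φ⟩} ∏_l ⟪φ(x_l), v_l⟫` are `Z` times the pairing sums of
the propagators `C^η_{M²}(x_l, x_{l'})⟪v_l, v_{l'}⟫`, and vanish for an odd number of legs

statement-level skeleton of published theorems with citation tags; proofs where landed; nothing here is a claim about
the Yang–Mills mass gap

PDF held: `paper:balaban1983-higgs-2-3-quantum-fields-finite-volume` (journal page = PDF page + 410); p. 414 [PDF 4] and pp. 430–431
[PDF 20–21] read on the ×4 renders `run/shared/lean/pub/pub-balaban/b2b-balaban-ref1/pages/1983-cmp88-higgs23-III/…-p004-x4.png`,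
`…-p020-x4.png`, `…-p021-x4.png`.

CITATION HEADER (lean-in-tree rule).  Part of the lit-balaban TYPED SKELETON (HOME `run/shared/lean/pub/lit-balaban/`), PHASE 2,
proof seat p39 (generation 13; v1.1 docstring-only, gen 14).  Row **B3.Eq2.26-2.28** ((2.26)–(2.28) p. 431) and row
**B3.Eq1.17-1.18** (p. 414, the contraction of legs) of `HOME/lit-balaban-r15/ROWS-B3.md` (fold owner r15).  THE MODEL: the
lattice model of `B3WT223Instance` (torus `Site P j`, fields `φ : Cfg P j N = Site P j → R^N`, Lebesgue measure `dφ`, the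
Gaussian weight `weight C η w c M2 0 φ = e^{−½⟨φ,Kφ⟩}`, `K = η^d(−Δ^η + M²)`, normalisation `Z = ∫dφ e^{−½⟨φ,Kφ⟩}`) with the
propagator `C^η_{M²} = B3WTPropagator.G w c M2 = K⁻¹`; on it this seat proved the covariance `B3WTCovariance.moment2` (gen 2), the
Gaussian integration by parts `B3WTCovariance.gaussIBP`, the FOUR-leg Wick theorem `B3WTWick.moment4` (gen 2) and the left
members of (2.26)/(2.28) (`B3WT226Derivative`, `B3WT228Left`, gen 3 and gen 13).  THIS FILE closes the Gaussian calculus of the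
model: the moments of EVERY order.

THE PRINTED TEXT (verbatim; v1.1: the two quotations of v1 flagged by ref-1 g64 / ref-4 S-B3-g48-1 replaced by the print).
p. 430 [PDF 20] L30: *"Now differentiating (2.24) with respect to A, connecting the vertices by properly localized propagators, and
calculating the Gaussian integrals … we get a set of Ward-Takahashi identities."*;  p. 431 [PDF 21] L4–5: *"Taking F = 1,
differentiating with respect to A and next taking A = 0 and using the identity (2.25), we get"* [(2.26)] *"or graphically"* [(2.27):
a display of FOUR pictures, each with the vector leg `A` and the leg `∂^ηλ` — two one-loop graphs and two tadpole graphs — summed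
`= 0`] *"where now the propagators are C^η_{M²}. Doing next the same operations as above but in the presence of
F(φ) = −λ_kΣ_{x∈Δ}η^d:|φ(x)|⁴:, we get the identities represented graphically in the following way:"* [(2.28): one two-loop picture
`= 0`] (our reading, not print: the pictures are the Wick contractions of the product of the two quadratic functionals, resp. of that
product with the quartic `F`);  p. 414 [PDF 4]: *"All the A′-legs are
contracted, i.e. they are divided into pairs and each pair is replaced by the corresponding propagator. … the remaining are again
divided into pairs and each pair is replaced by a propagator … multiplied by a proper combinatorial factor connected with the
number of ways given expression can be obtained from Gaussian integrals"*.

WHAT IS PROVED (theorems only; no definition, no `Prop`; standard axioms).  A leg is a pair `p = (x, v) : Site P j × R^N`, read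
as the linear functional `φ ↦ ⟪φ(x), v⟫`; the propagator of two legs is `C^η_{M²}(x, x')⟪v, v'⟫` (`B3WTCovariance.moment2`).
* §1 `abs_prod_inner_le`, `integrable_weight_mul_prod_inner`: growth `|∏_{l∈s}⟪φ(x_l),v_l⟫| ≤ (∏‖v_l‖)·sup|φ|^{|s|}` and
  integrability of `e^{−½⟨φ,Kφ⟩}∏_l⟪φ(x_l),v_l⟫` for every finite family of legs.
* §2 **`ibp_prod_inner` — Gaussian integration by parts of every order**:
  `∫dφ e^{−½⟨φ,Kφ⟩}⟪φ(x),v⟫∏_{l∈s}⟪φ(x_l),v_l⟫ = ∑_{l∈s} C^η_{M²}(x,x_l)⟪v,v_l⟫ ∫dφ e^{−½⟨φ,Kφ⟩}∏_{i∈s∖{l}}⟪φ(x_i),v_i⟫`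
  (`gaussIBP` in the direction `C^η_{M²}(·,x)⊗v`, the derivative of the product by `HasDerivAt.fun_finsetProd`).
* §3 **`moment_odd`**: `∫dφ e^{−½⟨φ,Kφ⟩}∏_{l<2k+1}⟪φ(x_l),v_l⟫ = 0`;  **`moment_eq_pairingSum` — Wick's theorem of every order**:
  `∫dφ e^{−½⟨φ,Kφ⟩}∏_{l<2k}⟪φ(x_l),v_l⟫ = Z · 𝒢_k[C^η_{M²}⊗⟪·,·⟫](x,v) = Z · ∑_{pairings}∏_{pairs {l,l'}} C^η_{M²}(x_l,x_{l'})⟪v_l,v_{l'}⟫`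
  (the tree's pairing functional `Literature.Probability.LatticeModels.pairingSum`), by the measure-free combinatorial engine
  `GaussianWick.integral_prod_eq_pairingSum_of_ibp` / `integral_prod_odd_eq_zero_of_ibp` of
  `Literature/Probability/Distributions/GaussianWickTheorem` (§7 there) applied to the measure `e^{−½⟨φ,Kφ⟩}dφ`
  (`Measure.withDensity`; bridge `integral_withDensity_weight`), whose total mass is `Z`.
* §4 `moment_div_Z_eq_pairingSum` (the normalised measure `dμ_{C^η_{M²}} = Z⁻¹e^{−½⟨φ,Kφ⟩}dφ`, `Z > 0` by
  `B3WT226Traces.Z_pos`); the cases `k = 1, 2` are the covariance `B3WTCovariance.moment2` and the three-term formula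
  `B3WTWick.moment4` of gen 2 (not restated).
* §5 the two other Gaussian measures of the (2.26) computation ("with periodic boundary conditions", gen 12 `B3WTPeriodicMeasure`):
  the torus measure `dμ_{C_T} = torusMeasure d N L η M2` (`integral_prod_eval_torusMeasure`: `∫∏_{l<2k}ω_T(p_l)dμ_{C_T} =
  𝒢_k[δ_{ab}C_T(s−t)]`, odd = 0, integration by parts) and the `L`-periodic field `dμ_{C_L} = periodicMeasure d N L η M2`
  (`integral_prod_inner_fld_periodicMeasure`: each pair of field insertions replaced by the periodised propagator `C_L(x−y)⟪v,w⟫`,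
  odd = 0, integration by parts) — the instances `K = torusKernel`, `C = C_L` of `B3GaussianContractions`.
Honest scope: these are the Gaussian integrals behind (2.26)–(2.28); the drawn right members of (2.27)/(2.28) (graphs with
`(1 − P(p′))C^η_{M²}` propagators and the `λ_k` vertex) are not typed here.
-/

noncomputable section

open scoped BigOperators InnerProductSpace NNReal ENNReal

namespace Literature.MathematicalPhysics.QuantumFieldTheory.Balaban1983to89.B3WTWickGeneral

open _root_.MeasureTheory Finset
open LatticeFieldCalculus B3WT223Instance B3WT224Instance B3WTPropagator B3WTCovariance B3WTWick
open Literature.Probability.LatticeModels (pairingSum)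
open Literature.Probability.Distributions.GaussianWick (integral_prod_eq_pairingSum_of_ibp integral_prod_odd_eq_zero_of_ibp)

variable {P : Params} {j N : ℕ} (C : HiggsLattice.ChargeData N) (η w c M2 : ℝ)

/-! ## §1 Growth and integrability of products of legs -/

/-- `sup|φ|^n ≤ e^{n·sup|φ|}`. [cite: Balaban1983Higgs3, (2.26) p.431] -/
private theorem pow_norm_le_exp (φ : Cfg P j N) (n : ℕ) : ‖φ‖ ^ n ≤ Real.exp (n * ‖φ‖) := by
  have h1 : ‖φ‖ ≤ Real.exp ‖φ‖ := by linarith [Real.add_one_le_exp ‖φ‖]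
  calc ‖φ‖ ^ n ≤ Real.exp ‖φ‖ ^ n := pow_le_pow_left₀ (norm_nonneg _) h1 n
    _ = Real.exp (n * ‖φ‖) := by rw [← Real.exp_nat_mul]

/-- growth of a product of legs: `|∏_{l∈s}⟪φ(x_l),v_l⟫| ≤ (∏_{l∈s}‖v_l‖)·sup|φ|^{|s|}`. [cite: Balaban1983Higgs3, (2.26)–(2.28) p.431] -/
theorem abs_prod_inner_le {κ : Type*} (s : Finset κ) (y : κ → Site P j × EuclideanSpace ℝ (Fin N)) (φ : Cfg P j N) :
    |∏ l ∈ s, ⟪φ (y l).1, (y l).2⟫_ℝ| ≤ (∏ l ∈ s, ‖(y l).2‖) * ‖φ‖ ^ s.card := by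
  rw [Finset.abs_prod, ← Finset.prod_const, ← Finset.prod_mul_distrib]
  exact Finset.prod_le_prod (fun _ _ => abs_nonneg _) fun l _ => abs_inner_apply_le φ (y l).1 (y l).2

/-- `e^{−½⟨φ,Kφ⟩}∏_{l∈s}⟪φ(x_l),v_l⟫` is integrable for every finite family of legs. [cite: Balaban1983Higgs3, (2.26)–(2.28) p.431] -/
theorem integrable_weight_mul_prod_inner (hw : 0 < w) (hM : 0 < M2) {κ : Type*} (s : Finset κ)
    (y : κ → Site P j × EuclideanSpace ℝ (Fin N)) :
    Integrable (fun φ => weight C η w c M2 (0 : VecField P j ℝ) φ * ∏ l ∈ s, ⟪φ (y l).1, (y l).2⟫_ℝ) :=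
  integrable_weight_mul C η w c M2 hw hM
    (continuous_finsetProd s fun l _ => (continuous_apply (y l).1).inner continuous_const)
    (K := ∏ l ∈ s, ‖(y l).2‖) (κ := (s.card : ℝ)) fun φ =>
    (abs_prod_inner_le s y φ).trans
      (mul_le_mul_of_nonneg_left (pow_norm_le_exp φ s.card) (Finset.prod_nonneg fun _ _ => norm_nonneg _))

/-! ## §2 Gaussian integration by parts of every order -/

/-- **Gaussian integration by parts of every order on the lattice model**: for a leg `(x,v)` and any finite family of legs,
`∫dφ e^{−½⟨φ,Kφ⟩}⟪φ(x),v⟫∏_{l∈s}⟪φ(x_l),v_l⟫ = ∑_{l∈s} C^η_{M²}(x,x_l)⟪v,v_l⟫ · ∫dφ e^{−½⟨φ,Kφ⟩}∏_{i∈s∖{l}}⟪φ(x_i),v_i⟫`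
— `B3WTCovariance.gaussIBP` in the direction `h = C^η_{M²}(·,x)⊗v` (`⟨φ,Kh⟩ = ⟪φ(x),v⟫`, `B3WTPropagator.Kbil_gcol`) applied to
the product, whose derivative along `h` is `∑_l ⟪h(x_l),v_l⟫∏_{i≠l}⟪φ(x_i),v_i⟫` with `⟪h(x_l),v_l⟫ = C^η_{M²}(x,x_l)⟪v,v_l⟫` ("the
propagators are C^η_{M²}"). [cite: Balaban1983Higgs3, (2.26)–(2.28) p.431] [cite: GlimmJaffeQP1987, Thm 6.3.1 (6.3.3)] -/
theorem ibp_prod_inner (hw : 0 < w) (hM : 0 < M2) (a : Site P j × EuclideanSpace ℝ (Fin N)) {κ : Type*} [DecidableEq κ]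
    (s : Finset κ) (y : κ → Site P j × EuclideanSpace ℝ (Fin N)) :
    ∫ φ, weight C η w c M2 (0 : VecField P j ℝ) φ * (⟪φ a.1, a.2⟫_ℝ * ∏ l ∈ s, ⟪φ (y l).1, (y l).2⟫_ℝ) =
      ∑ l ∈ s, (G w c M2 a.1 (y l).1 * ⟪a.2, (y l).2⟫_ℝ) *
        ∫ φ, weight C η w c M2 (0 : VecField P j ℝ) φ * ∏ i ∈ s.erase l, ⟪φ (y i).1, (y i).2⟫_ℝ := by
  set h : Cfg P j N := gcol w c M2 a.1 a.2 with hh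
  set g : Cfg P j N → ℝ := fun φ => ∏ l ∈ s, ⟪φ (y l).1, (y l).2⟫_ℝ with hg
  set g' : Cfg P j N → ℝ := fun φ => ∑ l ∈ s, (∏ i ∈ s.erase l, ⟪φ (y i).1, (y i).2⟫_ℝ) * ⟪h (y l).1, (y l).2⟫_ℝ with hg'
  set V : ℝ := ∏ l ∈ s, ‖(y l).2‖ with hV
  have hV0 : 0 ≤ V := Finset.prod_nonneg fun _ _ => norm_nonneg _
  have hn : ∀ (φ : Cfg P j N) (m : ℕ), m ≤ s.card → ‖φ‖ ^ m ≤ Real.exp ((s.card : ℝ) * ‖φ‖) := fun φ m hm =>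
    (pow_norm_le_exp φ m).trans (Real.exp_le_exp.mpr (mul_le_mul_of_nonneg_right (by exact_mod_cast hm) (norm_nonneg _)))
  have hmain := gaussIBP C η w c M2 hw hM h g g' (fun φ t => by
      have hd := HasDerivAt.fun_finsetProd (u := s) (x := t)
        (f := fun l (t : ℝ) => ⟪(φ + t • h) (y l).1, (y l).2⟫_ℝ) (f' := fun l => ⟪h (y l).1, (y l).2⟫_ℝ)
        fun l _ => hasDerivAt_inner_transl φ h (y l).1 (y l).2 t
      simpa only [hg, hg', smul_eq_mul] using hd)
    (continuous_finsetProd s fun l _ => (continuous_apply (y l).1).inner continuous_const)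
    (continuous_finsetSum s fun l _ =>
      (continuous_finsetProd _ fun i _ => (continuous_apply (y i).1).inner continuous_const).mul continuous_const)
    (K := V * (1 + s.card * ‖h‖)) (κ := (s.card : ℝ)) (Nat.cast_nonneg _)
    (fun φ => by
      calc |g φ| ≤ V * ‖φ‖ ^ s.card := abs_prod_inner_le s y φ
        _ ≤ V * Real.exp ((s.card : ℝ) * ‖φ‖) := mul_le_mul_of_nonneg_left (hn φ _ le_rfl) hV0
        _ ≤ V * (1 + s.card * ‖h‖) * Real.exp ((s.card : ℝ) * ‖φ‖) := by
            rw [mul_assoc]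
            refine mul_le_mul_of_nonneg_left ?_ hV0
            have : 0 ≤ (s.card : ℝ) * ‖h‖ := by positivity
            nlinarith [Real.exp_pos ((s.card : ℝ) * ‖φ‖)])
    (fun φ => by
      have hterm : ∀ l ∈ s, |(∏ i ∈ s.erase l, ⟪φ (y i).1, (y i).2⟫_ℝ) * ⟪h (y l).1, (y l).2⟫_ℝ| ≤
          V * ‖h‖ * ‖φ‖ ^ (s.card - 1) := fun l hl => by
        rw [abs_mul]
        calc |∏ i ∈ s.erase l, ⟪φ (y i).1, (y i).2⟫_ℝ| * |⟪h (y l).1, (y l).2⟫_ℝ|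
            ≤ ((∏ i ∈ s.erase l, ‖(y i).2‖) * ‖φ‖ ^ (s.erase l).card) * (‖(y l).2‖ * ‖h‖) :=
              mul_le_mul (abs_prod_inner_le _ y φ) (abs_inner_apply_le h _ _) (abs_nonneg _) (by positivity)
          _ = ((∏ i ∈ s.erase l, ‖(y i).2‖) * ‖(y l).2‖) * ‖h‖ * ‖φ‖ ^ (s.card - 1) := by
              rw [Finset.card_erase_of_mem hl]; ring
          _ = V * ‖h‖ * ‖φ‖ ^ (s.card - 1) := by rw [Finset.prod_erase_mul _ _ hl]
      calc |g' φ| ≤ ∑ l ∈ s, |(∏ i ∈ s.erase l, ⟪φ (y i).1, (y i).2⟫_ℝ) * ⟪h (y l).1, (y l).2⟫_ℝ| :=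
            Finset.abs_sum_le_sum_abs _ _
        _ ≤ ∑ l ∈ s, V * ‖h‖ * ‖φ‖ ^ (s.card - 1) := Finset.sum_le_sum hterm
        _ = V * (s.card * ‖h‖) * ‖φ‖ ^ (s.card - 1) := by rw [Finset.sum_const, nsmul_eq_mul]; ring
        _ ≤ V * (s.card * ‖h‖) * Real.exp ((s.card : ℝ) * ‖φ‖) :=
            mul_le_mul_of_nonneg_left (hn φ _ (Nat.sub_le _ _)) (by positivity)
        _ ≤ V * (1 + s.card * ‖h‖) * Real.exp ((s.card : ℝ) * ‖φ‖) :=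
            mul_le_mul_of_nonneg_right (mul_le_mul_of_nonneg_left (by linarith) hV0) (Real.exp_pos _).le)
  -- left side: `⟪φ(x),v⟫ = ⟨φ, K h⟩`
  have hlhs : (fun φ : Cfg P j N => weight C η w c M2 (0 : VecField P j ℝ) φ *
      (⟪φ a.1, a.2⟫_ℝ * ∏ l ∈ s, ⟪φ (y l).1, (y l).2⟫_ℝ)) =
      fun φ => weight C η w c M2 (0 : VecField P j ℝ) φ * (Kbil w c M2 φ h * g φ) := by
    funext φ
    rw [hh, Kbil_gcol w c M2 hw hM]
  rw [hlhs, hmain]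
  -- right side: `∫ e^{−½⟨φ,Kφ⟩} ∑_l (∏_{i≠l} …)⟪h(x_l),v_l⟫ = ∑_l ⟪h(x_l),v_l⟫ ∫ e^{−½⟨φ,Kφ⟩} ∏_{i≠l} …`
  have hrhs : (fun φ : Cfg P j N => weight C η w c M2 (0 : VecField P j ℝ) φ * g' φ) = fun φ =>
      ∑ l ∈ s, (weight C η w c M2 (0 : VecField P j ℝ) φ * ∏ i ∈ s.erase l, ⟪φ (y i).1, (y i).2⟫_ℝ) *
        ⟪h (y l).1, (y l).2⟫_ℝ := by
    funext φ
    rw [hg', Finset.mul_sum]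
    exact Finset.sum_congr rfl fun l _ => by ring
  rw [hrhs, integral_finsetSum _ fun l _ => (integrable_weight_mul_prod_inner C η w c M2 hw hM (s.erase l) y).mul_const _]
  refine Finset.sum_congr rfl fun l _ => ?_
  rw [integral_mul_const, hh]
  unfold gcol
  rw [real_inner_smul_left, G_symm w c M2 (y l).1 a.1]
  ring

/-! ## §3 Wick's theorem of every order for `dμ_{C^η_{M²}}` -/

/-- the bridge to the measure `e^{−½⟨φ,Kφ⟩}dφ`: `∫ F d(e^{−½⟨φ,Kφ⟩}dφ) = ∫dφ e^{−½⟨φ,Kφ⟩}F(φ)`. [cite: Balaban1983Higgs3, (2.23) p.430] -/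
theorem integral_withDensity_weight (F : Cfg P j N → ℝ) :
    ∫ φ, F φ ∂(volume.withDensity fun φ => ENNReal.ofReal (weight C η w c M2 (0 : VecField P j ℝ) φ)) =
      ∫ φ, weight C η w c M2 (0 : VecField P j ℝ) φ * F φ := by
  have hmeas : Measurable fun φ : Cfg P j N => (weight C η w c M2 (0 : VecField P j ℝ) φ).toNNReal :=
    (continuous_weight C η w c M2 _).measurable.real_toNNReal
  have h := integral_withDensity_eq_integral_smul (μ := volume) hmeas F
  refine (h.trans (integral_congr_ae (ae_of_all _ fun φ => ?_)))
  show (weight C η w c M2 (0 : VecField P j ℝ) φ).toNNReal • F φ = weight C η w c M2 (0 : VecField P j ℝ) φ * F φ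
  rw [NNReal.smul_def, smul_eq_mul, Real.coe_toNNReal _ (weight_pos _ φ).le]

/-- the total mass of `e^{−½⟨φ,Kφ⟩}dφ` is `Z = ∫dφ e^{−½⟨φ,Kφ⟩}`. [cite: Balaban1983Higgs3, (2.23) p.430] -/
theorem withDensity_weight_real_univ :
    (volume.withDensity fun φ : Cfg P j N => ENNReal.ofReal (weight C η w c M2 (0 : VecField P j ℝ) φ)).real Set.univ =
      ∫ φ, weight C η w c M2 (0 : VecField P j ℝ) φ := by
  have h := integral_withDensity_weight C η w c M2 (fun _ : Cfg P j N => (1 : ℝ))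
  simp only [integral_const, smul_eq_mul, mul_one] at h
  exact h

/-- the first-leg recursion for the measure `e^{−½⟨φ,Kφ⟩}dφ` (= `ibp_prod_inner` through the bridge). [cite: Balaban1983Higgs3, (2.26)–(2.28) p.431] -/
theorem ibp_prod_inner_withDensity (hw : 0 < w) (hM : 0 < M2) (a : Site P j × EuclideanSpace ℝ (Fin N)) (n : ℕ)
    (s : Finset (Fin n)) (y : Fin n → Site P j × EuclideanSpace ℝ (Fin N)) :
    ∫ φ, ⟪φ a.1, a.2⟫_ℝ * ∏ l ∈ s, ⟪φ (y l).1, (y l).2⟫_ℝ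
        ∂(volume.withDensity fun φ => ENNReal.ofReal (weight C η w c M2 (0 : VecField P j ℝ) φ)) =
      ∑ l ∈ s, (G w c M2 a.1 (y l).1 * ⟪a.2, (y l).2⟫_ℝ) * ∫ φ, ∏ i ∈ s.erase l, ⟪φ (y i).1, (y i).2⟫_ℝ
        ∂(volume.withDensity fun φ => ENNReal.ofReal (weight C η w c M2 (0 : VecField P j ℝ) φ)) := by
  rw [integral_withDensity_weight, ibp_prod_inner C η w c M2 hw hM a s y]
  exact Finset.sum_congr rfl fun l _ => by rw [integral_withDensity_weight]

/-- **Odd moments of `dμ_{C^η_{M²}}` vanish**: `∫dφ e^{−½⟨φ,Kφ⟩}∏_{l<2k+1}⟪φ(x_l),v_l⟫ = 0`. [cite: Balaban1983Higgs3, (2.26)–(2.28) p.431]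
[cite: GlimmJaffeQP1987, §8.2 (8.2.4)] -/
theorem moment_odd (hw : 0 < w) (hM : 0 < M2) (k : ℕ) (p : Fin (2 * k + 1) → Site P j × EuclideanSpace ℝ (Fin N)) :
    ∫ φ, weight C η w c M2 (0 : VecField P j ℝ) φ * ∏ l, ⟪φ (p l).1, (p l).2⟫_ℝ = 0 := by
  rw [← integral_withDensity_weight]
  exact integral_prod_odd_eq_zero_of_ibp (L := fun (q : Site P j × EuclideanSpace ℝ (Fin N)) (φ : Cfg P j N) => ⟪φ q.1, q.2⟫_ℝ)
    (S := fun q q' : Site P j × EuclideanSpace ℝ (Fin N) => G w c M2 q.1 q'.1 * ⟪q.2, q'.2⟫_ℝ)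
    (ibp_prod_inner_withDensity C η w c M2 hw hM) k p

/-- **Wick's theorem of every order for `dμ_{C^η_{M²}}`.**  For any `2k` legs `(x_l, v_l)` (repetitions allowed),
`∫dφ e^{−½⟨φ,Kφ⟩}∏_{l<2k}⟪φ(x_l),v_l⟫ = Z · 𝒢_k[C^η_{M²}⊗⟪·,·⟫]((x_l,v_l)_l) = Z · ∑_{pairings}∏_{pairs {l,l'}} C^η_{M²}(x_l,x_{l'})⟪v_l,v_{l'}⟫`
— p. 430 "calculating the Gaussian integrals", p. 431 "where now the propagators are C^η_{M²}": every leg contracted with another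
one and each pair replaced by the propagator. [cite: Balaban1983Higgs3, (2.26)–(2.28) p.431 and p.414] [cite: GlimmJaffeQP1987, §8.2 (8.2.4)] [cite: Janson1997, Thm 1.28] -/
theorem moment_eq_pairingSum (hw : 0 < w) (hM : 0 < M2) (k : ℕ) (p : Fin (2 * k) → Site P j × EuclideanSpace ℝ (Fin N)) :
    ∫ φ, weight C η w c M2 (0 : VecField P j ℝ) φ * ∏ l, ⟪φ (p l).1, (p l).2⟫_ℝ =
      (∫ φ, weight C η w c M2 (0 : VecField P j ℝ) φ) *
        pairingSum (fun q q' : Site P j × EuclideanSpace ℝ (Fin N) => G w c M2 q.1 q'.1 * ⟪q.2, q'.2⟫_ℝ) k p := by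
  rw [← integral_withDensity_weight, ← withDensity_weight_real_univ]
  exact integral_prod_eq_pairingSum_of_ibp (L := fun (q : Site P j × EuclideanSpace ℝ (Fin N)) (φ : Cfg P j N) => ⟪φ q.1, q.2⟫_ℝ)
    (S := fun q q' : Site P j × EuclideanSpace ℝ (Fin N) => G w c M2 q.1 q'.1 * ⟪q.2, q'.2⟫_ℝ)
    (ibp_prod_inner_withDensity C η w c M2 hw hM) k p

/-- Wick's theorem of every order, sites and colour vectors listed separately: `∫dφ e^{−½⟨φ,Kφ⟩}∏_{l<2k}⟪φ(x_l),v_l⟫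
= Z·𝒢_k[C^η_{M²}(x_·,x_·)⟪v_·,v_·⟫]`. [cite: Balaban1983Higgs3, (2.26)–(2.28) p.431 and p.414] -/
theorem moment_eq_pairingSum' (hw : 0 < w) (hM : 0 < M2) (k : ℕ) (x : Fin (2 * k) → Site P j)
    (v : Fin (2 * k) → EuclideanSpace ℝ (Fin N)) :
    ∫ φ, weight C η w c M2 (0 : VecField P j ℝ) φ * ∏ l, ⟪φ (x l), v l⟫_ℝ =
      (∫ φ, weight C η w c M2 (0 : VecField P j ℝ) φ) *
        pairingSum (fun q q' : Site P j × EuclideanSpace ℝ (Fin N) => G w c M2 q.1 q'.1 * ⟪q.2, q'.2⟫_ℝ) k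
          (fun l => (x l, v l)) :=
  moment_eq_pairingSum C η w c M2 hw hM k fun l => (x l, v l)

/-- odd moments vanish, sites and colour vectors listed separately. [cite: Balaban1983Higgs3, (2.26)–(2.28) p.431] -/
theorem moment_odd' (hw : 0 < w) (hM : 0 < M2) (k : ℕ) (x : Fin (2 * k + 1) → Site P j)
    (v : Fin (2 * k + 1) → EuclideanSpace ℝ (Fin N)) :
    ∫ φ, weight C η w c M2 (0 : VecField P j ℝ) φ * ∏ l, ⟪φ (x l), v l⟫_ℝ = 0 :=
  moment_odd C η w c M2 hw hM k fun l => (x l, v l)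

/-! ## §4 The normalised form -/

/-- **Wick's theorem for the normalised measure `dμ_{C^η_{M²}} = Z⁻¹e^{−½⟨φ,Kφ⟩}dφ`**:
`∫dμ_{C^η_{M²}} ∏_{l<2k}⟪φ(x_l),v_l⟫ = 𝒢_k[C^η_{M²}⊗⟪·,·⟫]((x_l,v_l)_l)` (`Z > 0`, `B3WT226Traces.Z_pos`). [cite: Balaban1983Higgs3, (2.26)–(2.28) p.431 and p.414] -/
theorem moment_div_Z_eq_pairingSum (hw : 0 < w) (hM : 0 < M2) (k : ℕ) (p : Fin (2 * k) → Site P j × EuclideanSpace ℝ (Fin N)) :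
    (∫ φ, weight C η w c M2 (0 : VecField P j ℝ) φ * ∏ l, ⟪φ (p l).1, (p l).2⟫_ℝ) /
        (∫ φ, weight C η w c M2 (0 : VecField P j ℝ) φ) =
      pairingSum (fun q q' : Site P j × EuclideanSpace ℝ (Fin N) => G w c M2 q.1 q'.1 * ⟪q.2, q'.2⟫_ℝ) k p := by
  rw [moment_eq_pairingSum C η w c M2 hw hM k p, mul_div_cancel_left₀ _ (B3WT226Traces.Z_pos C η w c M2 hw hM).ne']

/-! ## §5 The torus Gaussian measure `dμ_{C_T}` and the `L`-periodic field `dμ_{C_L}` of `B3WTPeriodicMeasure`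

The two other Gaussian measures of the (2.26) computation constructed by this seat (gen 12, `B3WTPeriodicMeasure`): the torus
measure `torusMeasure d N L η M2 = dμ_{C_T}` on `ω_T : (ℤ/Lℤ)^d × Fin N → ℝ` (covariance `δ_{ab}C_T(s − t)`, the Gaussian field of
the kernel `torusKernel`) and the `L`-periodic field `periodicMeasure d N L η M2 = dμ_{C_L}` on `ηℤ^d` (covariance
`δ_{ab}C_L(x − y)`, `C_L` the periodised `C^η_{M²}`) — *"with periodic boundary conditions"* (p. 431).  Their moments of every
order are the instances `K = torusKernel`, `C = C_L` of `B3GaussianContractions` (§1–§2 there). -/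

section Periodic

open B3WTPeriodicMeasure

variable {d L : ℕ} [NeZero L] {η' M2' : ℝ}

/-- **Wick's theorem of every order for the torus Gaussian measure `dμ_{C_T}`**: `∫ ∏_{l<2k} ω_T(p_l) dμ_{C_T} = 𝒢_k[δ_{ab}C_T(s−t)](p)`.
[cite: Balaban1983Higgs3, (2.26) p.431 («with periodic boundary conditions») and p.414] [cite: Janson1997, Thm 1.28 (1.2)] -/
theorem integral_prod_eval_torusMeasure (hη : 0 < η') (hM : 0 < M2') (hL : 1 ≤ L) (k : ℕ) (p : Fin (2 * k) → TIdx d N L) :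
    ∫ ω, ∏ l, ω (p l) ∂torusMeasure d N L η' M2' = pairingSum (torusKernel d N L η' M2') k p :=
  B3GaussianContractions.integral_prod_eval_eq_pairingSum (isPosSemidefKernel_torusKernel hη hM hL) k p

/-- odd moments of `dμ_{C_T}` vanish. [cite: Balaban1983Higgs3, (2.26) p.431] [cite: Janson1997, Rem. 1.29] -/
theorem integral_prod_eval_torusMeasure_odd (hη : 0 < η') (hM : 0 < M2') (hL : 1 ≤ L) (k : ℕ)
    (p : Fin (2 * k + 1) → TIdx d N L) : ∫ ω, ∏ l, ω (p l) ∂torusMeasure d N L η' M2' = 0 :=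
  B3GaussianContractions.integral_prod_eval_odd (isPosSemidefKernel_torusKernel hη hM hL) k p

/-- Gaussian integration by parts for `dμ_{C_T}`: `∫ ω_T(a)∏_{j∈s}ω_T(c_j) dμ_{C_T} = Σ_{j∈s} (δC_T)(a,c_j) ∫ ∏_{i∈s∖j} ω_T(c_i) dμ_{C_T}`.
[cite: Balaban1983Higgs3, (2.26) p.431] [cite: GlimmJaffeQP1987, Thm 6.3.1 (6.3.3)] -/
theorem integral_eval_mul_prod_eval_torusMeasure (hη : 0 < η') (hM : 0 < M2') (hL : 1 ≤ L) (a : TIdx d N L) {κ : Type*}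
    [DecidableEq κ] (s : Finset κ) (c' : κ → TIdx d N L) :
    ∫ ω, ω a * ∏ j ∈ s, ω (c' j) ∂torusMeasure d N L η' M2' =
      ∑ j ∈ s, torusKernel d N L η' M2' a (c' j) * ∫ ω, ∏ i ∈ s.erase j, ω (c' i) ∂torusMeasure d N L η' M2' :=
  B3GaussianContractions.integral_eval_mul_prod_eval (isPosSemidefKernel_torusKernel hη hM hL) a s c'

/-- **Wick's theorem of every order for the `L`-periodic field `dμ_{C_L}`**: for any `2k` field insertions `⟪φ(x_l), v_l⟫`,
`∫ ∏_{l<2k} ⟪φ(x_l),v_l⟫ dμ_{C_L} = 𝒢_k[C_L(x−y)⟪v,w⟫]((x_l,v_l)_l)` — each pair of legs replaced by the periodised propagator.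
[cite: Balaban1983Higgs3, (2.26) p.431 («with periodic boundary conditions») and p.414] [cite: Janson1997, Thm 1.28 (1.2)] -/
theorem integral_prod_inner_fld_periodicMeasure (hη : 0 < η') (hM : 0 < M2') (hL : 1 ≤ L) (k : ℕ)
    (x : Fin (2 * k) → B3Sect3VectorSelfEnergy.ZSite d) (v : Fin (2 * k) → EuclideanSpace ℝ (Fin N)) :
    ∫ ω, ∏ l, ⟪B3WTFreeWick.fld ω (x l), v l⟫_ℝ ∂periodicMeasure d N L η' M2' =
      pairingSum (fun p q : B3Sect3VectorSelfEnergy.ZSite d × EuclideanSpace ℝ (Fin N) =>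
        B3WT226PeriodicLimit.perC L (B3WT226FreeLattice.CetaM d η' M2') (p.1 - q.1) * ⟪p.2, q.2⟫_ℝ) k (fun l => (x l, v l)) :=
  B3GaussianContractions.integral_prod_inner_fld_eq_pairingSum (isPosSemidefKernel_periodic hη hM hL) k x v

/-- odd numbers of field insertions integrate to zero under `dμ_{C_L}`. [cite: Balaban1983Higgs3, (2.26) p.431] [cite: Janson1997, Rem. 1.29] -/
theorem integral_prod_inner_fld_periodicMeasure_odd (hη : 0 < η') (hM : 0 < M2') (hL : 1 ≤ L) (k : ℕ)
    (x : Fin (2 * k + 1) → B3Sect3VectorSelfEnergy.ZSite d) (v : Fin (2 * k + 1) → EuclideanSpace ℝ (Fin N)) :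
    ∫ ω, ∏ l, ⟪B3WTFreeWick.fld ω (x l), v l⟫_ℝ ∂periodicMeasure d N L η' M2' = 0 :=
  B3GaussianContractions.integral_prod_inner_fld_odd (isPosSemidefKernel_periodic hη hM hL) k x v

/-- Gaussian integration by parts for the field insertions under `dμ_{C_L}`.
[cite: Balaban1983Higgs3, (2.26) p.431] [cite: GlimmJaffeQP1987, Thm 6.3.1 (6.3.3)] -/
theorem integral_inner_fld_mul_prod_periodicMeasure (hη : 0 < η') (hM : 0 < M2') (hL : 1 ≤ L)
    (x₀ : B3Sect3VectorSelfEnergy.ZSite d) (v₀ : EuclideanSpace ℝ (Fin N)) {κ : Type*} [DecidableEq κ] (s : Finset κ)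
    (y : κ → B3Sect3VectorSelfEnergy.ZSite d) (u : κ → EuclideanSpace ℝ (Fin N)) :
    ∫ ω, ⟪B3WTFreeWick.fld ω x₀, v₀⟫_ℝ * ∏ j ∈ s, ⟪B3WTFreeWick.fld ω (y j), u j⟫_ℝ ∂periodicMeasure d N L η' M2' =
      ∑ j ∈ s, B3WT226PeriodicLimit.perC L (B3WT226FreeLattice.CetaM d η' M2') (x₀ - y j) * ⟪v₀, u j⟫_ℝ *
        ∫ ω, ∏ i ∈ s.erase j, ⟪B3WTFreeWick.fld ω (y i), u i⟫_ℝ ∂periodicMeasure d N L η' M2' :=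
  B3GaussianContractions.integral_inner_fld_mul_prod (isPosSemidefKernel_periodic hη hM hL) x₀ v₀ s y u

end Periodic

end Literature.MathematicalPhysics.QuantumFieldTheory.Balaban1983to89.B3WTWickGeneral

end
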